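import Summits.QuantumFields.YangMills.Theorems.BalabanUVNodesN19RateEdgeHolderD4AtTuningWindow
import Summits.QuantumFields.YangMills.Theorems.BalabanUVNodesN22AtU3OfKernels

/-!
# BalabanUVNodes ∕ N19 — THE N19′ LINK READING AT THE (t-U3) PIN: def-W1's kernel objects of record are BACKGROUND-FREE, so every
# background-deviation term of NODE O's E-ledger VANISHES, the gauge-domination clause holds outright, and the tube block (T) reduces
# to «uniform (5.10) decay of the limiting kernels of record» (which implies the (D4) letter at every direction pair)

Cell `pub-ymgap`, HUMAN RULING D-0062 (Track A) ∕ D-0149 ∕ D-0154 (director-ym R399 (3a), №207 width wave), width seat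
`pub-ymgap-dag-n19-w5` (generation 0), FILE 2.  THEOREMS ONLY (0 `def`, 0 `sorry`); imports dag-n19-w3 g2's edition of record
`BalabanUVNodesN19RateEdgeHolderD4AtTuningWindow` (p602238; vocabulary of the displayed clauses) and dag-n22-w3's `BalabanUVNodesN22AtU3OfKernels`
(the pin shape, `objectsOfRecord₁₃`) ONLY; modifies nothing; `--kind proof --supports` K3⁷ `SpineGivenEndpointR13SepCoPH` (stmt-QuantumFields-20544)
`--as helper` — COUNT-NEUTRAL.  Bus: CLAIM-2 ∕ INTENT-2 + LOCATED-U3PIN (R455 (A), own located gap), INBOX l.29650.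

WHAT.  Since K3⁷ v3 (plan g81 (t-U3); carried by v4 17c74fac127b5f61 and v5 941dddb108cbaacf) the reading's node-U3 objects are PINNED BY NAME,
`U3PinnedKernels 𝔯 ℓ : ∀ F θ hP g₀ os, (𝔯.lit F θ hP g₀ os).u3 = objectsOfRecord₁₃ F 2 θ.toStage13Params (ℓ F θ)`, so at every tuple and run length
`R := rateCarriersOfRecord₁₃CoPH 𝔯 F θ hP g₀ os k` has `R.u3 = u3OfRecord₁₃ θ (objectsOfRecord₁₃ F N θ ℓ) k`: carriers `U3OfKernels.carriers`
(`BgA = BgB := PUnit`, `gauge := 0`, `transport := id` — background-free BY PRINT: the (1.20) kernel is the Hessian of E^{(j+1)} at `B = 0`,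
def-W1 W1-19 p59xxxx, INBOX l.25483 «background clauses DEGENERATE honestly»), functional `EA := fun g _ p => kernelA … g p…` (ignores the background).
This file draws the consequences FOR THE N19′ LINK READING `hlink` (dag-n19-d `…N19RateEdgeHolder`; dag-n19-w3 g2's edition of record
`…N19RateEdgeHolderD4AtTuningWindow`), whose NODE-O blocks READ backgrounds through `R.u3`:
* §1 [decided, `rfl` ∕ `simp`] at the pinned bundle: `EA`∕`EB` do not read the background (`EA_bg_irrel`, `EB_bg_irrel`); the gauge vanishes (`gauge_eq_zero`);
  the decay letter is `ℓ.κ` (`kappa_eq_letter` — the (ii-m) κ-row is a LETTER ROW);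
  EVERY E-factor `exp (EA s (uA K v) X − EA s oneA X)` is `1` and every product of them is `1` (`efactorA_eq_one`, `efactorProdA_eq_one`, `…B…`); the slice
  deviation sums of (i) ∕ `LedgerAtSync.size` VANISH (`sliceDev_eq_zero`) — so (i)'s slice hypothesis, (ii-v-A)∕(ii-v-B)'s deviation bounds and (ii-d)'s size
  clauses hold with ZERO left-hand sides, and `fmtA`∕`fmtB` read `A − shA = ∫ v, oA K t τ v ∂μ` (`integrand_fmtA_eq`).
* §2 [bookkeeping] the tube block (T) at the pinned bundle: the pair-disc analyticity clause FOLLOWS from `DecayBound` with CONSTANT witnesses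
  (`tubeDiscs_of_decayBound`); `0 ≤ E₀T` follows (`E₀_nonneg_of_decayBound`); `DecayBound` on the record window IMPLIES the (D4) letter
  `KernelDecayOfRecord₁₃ F N θ μ ν κ` at EVERY direction pair (`kernelDecayOfRecord₁₃_of_decayBound`, def-W1's `kernelDecay_of_decayBound`); window
  monotonicity (`decayBound_window_mono`).  So at the pin (T) = «uniform (5.10) decay of the limiting kernels of record on the tuning window, ONE constant»
  — STRONGER than stub 1's displayed (D4) letter (per-sequence constant, one direction pair).
* §3 [decided] the (v′-16) gauge-domination clause `hdomC1` of the link reading holds OUTRIGHT at the pinned bundle (`hdomC1_atPin`: its conclusion is `0 ≤ M`,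
  which its own norm hypothesis gives).
* §4 [bookkeeping] transfer to the reading under the pin equation `hpin` (`u3_rateCarriersOfRecord₁₃CoPH_of_pin`) and the §1∕§3 faces AT `R.u3`.

LOCATED (count-neutral; for plan g82 ∕ NODE O ∕ def-W1 — said, not asked).  At the (t-U3) pin the (2.25) E-ledger of the N19′ link reading is
BACKGROUND-BLIND: the spine cores' data dependence is carried by NE3's reading action `e^{−R.act K v}` and the other-kinds ledger ONLY (`ofmtA`), the
E-ledger contributing its v-FREE vacuum sums (where N18 ∕ N22 still act through `dev`).  In print the ledger's E-factors are the background-DEPENDENT localized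
terms E^{(j)}(X, U) of [Balaban1987RG1] (0.24)–(0.25) p. 257 (tree shape `Node00/LocalizedTermsShape`), whose Hessians at `B = 0` are the (1.20) kernels:
ONE `u3` slot serves the K4 kernel slots (N17 ∕ N18 ∕ N22 ∕ (D4): fine) AND N19's ledger (needs backgrounds).  Options are the owners'; node00-def-W1 g33
(LOCATED-ANSWER, INBOX l.29865): option (b) needs NO new definer object — the background-DEPENDENT node-U3 objects already exist in TERM currency (W1-2∕W1-3∕W1-4
`Node00.W1.ReadingData.u3Objects`, backgrounds `GaugeField (F.P k) 0 (SU N)`), with the junction to the kernel pin W1-20 `Localizes17OfRecord₁₃`; a later K3 edition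
wanting backgrounds in N19's E-ledger reads the E-factors there and keeps `U3PinnedKernels` for the K4 slots.

HONEST FRAMING.  By-name bookkeeping; `rfl` ∕ `simp` ∕ constant-function facts; ZERO estimate content; nothing of Bałaban's asserted or refuted; no stub
closed; NE7 ∕ NE9 ∕ NE5 NOT PRINTED as two-run statements for d = 4 and NOT proved; N19 NOT discharged; K3⁷ v5 UNTOUCHED, OPEN, not claimed; counts
UNMOVED (typed 28∕28 · discharged 5∕27 · A 5∕28).  One finite 𝕋⁴ programme at fixed ε — R4 closes the CONDITIONAL rung `BalabanLadder.UV` only; the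
Yang–Mills mass gap (Clay) is NOT proved by any of this; nothing continuum ∕ ℝ⁴ ∕ OS.  No summit statement is proved by this seat.  [folklore] throughout.
-/

noncomputable section

namespace Summit.QuantumFields.YangMills.BalabanUVNodes.N19LinkReadingAtU3Pin

open Finset MeasureTheory
open scoped BigOperators Matrix Matrix.Norms.L2Operator
open Literature.MathematicalPhysics.QuantumFieldTheory.Balaban1983to89
open Literature.MathematicalPhysics.QuantumFieldTheory.Balaban1983to89.T4Continuum (T4Family ULoop)
open Summit.QuantumFields.BalabanUV.T4Continuum
open Literature.MathematicalPhysics.QuantumFieldTheory.Balaban1983to89.T4OutputRate (Window DecayBound)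
open Literature.MathematicalPhysics.QuantumFieldTheory.Balaban1983to89.Node00 (Stage13Params Stage13HParams U3Letters₁₁)
open Literature.MathematicalPhysics.QuantumFieldTheory.Balaban1983to89.Node00.U3OfKernels (carriers pt bg objectsOfRecord₁₃ KernelDecayOfRecord₁₃
  kernelDecayOfRecord₁₃_iff)
open YMDAG.UVSplit (U3Carriers RateCarriers RateReading₁₃CoPH u3OfRecord₁₃ rateCarriersOfRecord₁₃CoPH)

variable {N : ℕ} [NeZero N]

/-! ## §1 At the pinned bundle the functionals do not read the background: every E-factor deviation vanishes -/

section BackgroundBlind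

variable {F : T4Family} (θ : Stage13Params F N) (ℓ : U3Letters₁₁) (k : ℕ)

/-- **RUN A's FUNCTIONAL OF RECORD DOES NOT READ THE BACKGROUND** (`rfl`): def-W1's `EA := fun g _ p => kernelA …`. [folklore] -/
theorem EA_bg_irrel (s : ℕ → ℝ) (U U' : (u3OfRecord₁₃ θ (objectsOfRecord₁₃ F N θ ℓ) k).C.BgA)
    (X : (u3OfRecord₁₃ θ (objectsOfRecord₁₃ F N θ ℓ) k).C.Dom) :
    (u3OfRecord₁₃ θ (objectsOfRecord₁₃ F N θ ℓ) k).EA s U X = (u3OfRecord₁₃ θ (objectsOfRecord₁₃ F N θ ℓ) k).EA s U' X := rfl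

/-- **RUN B's FIRST-COUPLING FAMILY OF RECORD DOES NOT READ THE BACKGROUND** (`rfl`). [folklore] -/
theorem EB_bg_irrel (b : ℝ) (s : ℕ → ℝ) (U U' : (u3OfRecord₁₃ θ (objectsOfRecord₁₃ F N θ ℓ) k).C.BgB)
    (X : (u3OfRecord₁₃ θ (objectsOfRecord₁₃ F N θ ℓ) k).C.Dom) :
    (u3OfRecord₁₃ θ (objectsOfRecord₁₃ F N θ ℓ) k).EB b s U X = (u3OfRecord₁₃ θ (objectsOfRecord₁₃ F N θ ℓ) k).EB b s U' X := rfl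

/-- **THE GAUGE OF THE PINNED CARRIERS VANISHES** (`rfl`): `U3OfKernels.carriers.gauge := 0`. [folklore] -/
theorem gauge_eq_zero (U : (u3OfRecord₁₃ θ (objectsOfRecord₁₃ F N θ ℓ) k).C.BgA) (U' : (u3OfRecord₁₃ θ (objectsOfRecord₁₃ F N θ ℓ) k).C.BgA) :
    (u3OfRecord₁₃ θ (objectsOfRecord₁₃ F N θ ℓ) k).C.gauge U U' = 0 := rfl

/-- The transport of the pinned carriers is the identity (`rfl`). [folklore] -/
theorem transport_eq (U : (u3OfRecord₁₃ θ (objectsOfRecord₁₃ F N θ ℓ) k).C.BgB) :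
    (u3OfRecord₁₃ θ (objectsOfRecord₁₃ F N θ ℓ) k).C.transport U = U := rfl

/-- **THE DECAY LETTER OF THE PINNED BUNDLE IS THE LETTER BLOCK's `κ`** (`rfl`): so the (ii-m) row `kappa₀ (4·2^{d₀}) (2·d₀) ≤ R.u3.κ` and (T)'s rate read
`(ℓ F θ).κ` — uniform in `(hP, g₀, os, k)`, a LETTER ROW. [folklore] -/
theorem kappa_eq_letter : (u3OfRecord₁₃ θ (objectsOfRecord₁₃ F N θ ℓ) k).κ = ℓ.κ := rfl

/-- **EVERY RUN-A E-FACTOR DEVIATION IS ZERO** at the pinned bundle. [folklore] -/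
theorem devA_eq_zero (s : ℕ → ℝ) (U U' : (u3OfRecord₁₃ θ (objectsOfRecord₁₃ F N θ ℓ) k).C.BgA)
    (X : (u3OfRecord₁₃ θ (objectsOfRecord₁₃ F N θ ℓ) k).C.Dom) :
    (u3OfRecord₁₃ θ (objectsOfRecord₁₃ F N θ ℓ) k).EA s U X - (u3OfRecord₁₃ θ (objectsOfRecord₁₃ F N θ ℓ) k).EA s U' X = 0 :=
  sub_self _

/-- **EVERY RUN-B E-FACTOR DEVIATION IS ZERO** at the pinned bundle. [folklore] -/
theorem devB_eq_zero (b : ℝ) (s : ℕ → ℝ) (U U' : (u3OfRecord₁₃ θ (objectsOfRecord₁₃ F N θ ℓ) k).C.BgB)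
    (X : (u3OfRecord₁₃ θ (objectsOfRecord₁₃ F N θ ℓ) k).C.Dom) :
    (u3OfRecord₁₃ θ (objectsOfRecord₁₃ F N θ ℓ) k).EB b s U X - (u3OfRecord₁₃ θ (objectsOfRecord₁₃ F N θ ℓ) k).EB b s U' X = 0 :=
  sub_self _

/-- **EVERY PRODUCT OF RUN-A E-FACTORS IS `1`** at the pinned bundle (the `fmtA` ∕ `off` ∕ `int` integrand's E-ledger factor), any ledger `fac`,
any background map. [folklore] -/
theorem efactorProdA_eq_one (fac : Finset (u3OfRecord₁₃ θ (objectsOfRecord₁₃ F N θ ℓ) k).C.Dom) (s : ℕ → ℝ)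
    (U U' : (u3OfRecord₁₃ θ (objectsOfRecord₁₃ F N θ ℓ) k).C.BgA) :
    ∏ X ∈ fac, Real.exp ((u3OfRecord₁₃ θ (objectsOfRecord₁₃ F N θ ℓ) k).EA s U X - (u3OfRecord₁₃ θ (objectsOfRecord₁₃ F N θ ℓ) k).EA s U' X) = 1 :=
  Finset.prod_eq_one fun X _ => by rw [devA_eq_zero, Real.exp_zero]

/-- **EVERY PRODUCT OF RUN-B E-FACTORS IS `1`** at the pinned bundle. [folklore] -/
theorem efactorProdB_eq_one (fac : Finset (u3OfRecord₁₃ θ (objectsOfRecord₁₃ F N θ ℓ) k).C.Dom) (b : ℝ) (s : ℕ → ℝ)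
    (U U' : (u3OfRecord₁₃ θ (objectsOfRecord₁₃ F N θ ℓ) k).C.BgB) :
    ∏ X ∈ fac, Real.exp ((u3OfRecord₁₃ θ (objectsOfRecord₁₃ F N θ ℓ) k).EB b s U X - (u3OfRecord₁₃ θ (objectsOfRecord₁₃ F N θ ℓ) k).EB b s U' X) = 1 :=
  Finset.prod_eq_one fun X _ => by rw [devB_eq_zero, Real.exp_zero]

/-- **THE `fmtA` INTEGRAND AT THE PIN IS THE OTHER-KINDS FACTOR ALONE**: `(∏ E-factors) · oA v = oA v`; hence `A K t τ = ∫ v, oA K t τ v ∂μ` under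
`LedgerAtSync.fmtA` (any measure, any `fac`, any background map — `integral_congr` of this pointwise identity). [folklore] -/
theorem integrand_fmtA_eq {ι : Type} (fac : Finset (u3OfRecord₁₃ θ (objectsOfRecord₁₃ F N θ ℓ) k).C.Dom) (s : ℕ → ℝ)
    (uA : ι → (u3OfRecord₁₃ θ (objectsOfRecord₁₃ F N θ ℓ) k).C.BgA) (oneA : (u3OfRecord₁₃ θ (objectsOfRecord₁₃ F N θ ℓ) k).C.BgA) (oA : ι → ℝ)
    (v : ι) :
    (∏ X ∈ fac, Real.exp ((u3OfRecord₁₃ θ (objectsOfRecord₁₃ F N θ ℓ) k).EA s (uA v) X - (u3OfRecord₁₃ θ (objectsOfRecord₁₃ F N θ ℓ) k).EA s oneA X)) *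
        oA v = oA v := by
  rw [efactorProdA_eq_one, one_mul]

/-- **THE `fmtB` INTEGRAND AT THE PIN IS THE OTHER-KINDS FACTOR ALONE.** [folklore] -/
theorem integrand_fmtB_eq {ι : Type} (fac : Finset (u3OfRecord₁₃ θ (objectsOfRecord₁₃ F N θ ℓ) k).C.Dom) (b : ℝ) (s : ℕ → ℝ)
    (uB : ι → (u3OfRecord₁₃ θ (objectsOfRecord₁₃ F N θ ℓ) k).C.BgB) (oneB : (u3OfRecord₁₃ θ (objectsOfRecord₁₃ F N θ ℓ) k).C.BgB) (oB : ι → ℝ)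
    (v : ι) :
    (∏ X ∈ fac, Real.exp ((u3OfRecord₁₃ θ (objectsOfRecord₁₃ F N θ ℓ) k).EB b s (uB v) X - (u3OfRecord₁₃ θ (objectsOfRecord₁₃ F N θ ℓ) k).EB b s oneB X)) *
        oB v = oB v := by
  rw [efactorProdB_eq_one, one_mul]

/-- **THE SLICE DEVIATION SUM OF THE LEDGER VANISHES AT THE PIN**: the left-hand side of (i)'s slice hypothesis and of `LedgerAtSync.size` — the
scale-`j` slice sum of `log (E-factor_B) − log (E-factor_A)` — is `0`, for every slice `fac`, scale reading `sc`, backgrounds, coupling tables and every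
first-coupling selector `bsel` (the link reading's `EB = fun s => R.u3.EB (bsel s) s`). [folklore] -/
theorem sliceDev_eq_zero {ι : Type} (fac : Finset (u3OfRecord₁₃ θ (objectsOfRecord₁₃ F N θ ℓ) k).C.Dom)
    (sc : (u3OfRecord₁₃ θ (objectsOfRecord₁₃ F N θ ℓ) k).C.Dom → ℕ) (j : ℕ)
    (sA sB : ℕ → ℝ) (bsel : (ℕ → ℝ) → ℝ)
    (uA : ι → (u3OfRecord₁₃ θ (objectsOfRecord₁₃ F N θ ℓ) k).C.BgA) (oneA : (u3OfRecord₁₃ θ (objectsOfRecord₁₃ F N θ ℓ) k).C.BgA)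
    (uB : ι → (u3OfRecord₁₃ θ (objectsOfRecord₁₃ F N θ ℓ) k).C.BgB) (oneB : (u3OfRecord₁₃ θ (objectsOfRecord₁₃ F N θ ℓ) k).C.BgB) (v : ι) :
    ∑ X ∈ fac with sc X = j,
        (Real.log (Real.exp ((u3OfRecord₁₃ θ (objectsOfRecord₁₃ F N θ ℓ) k).EB (bsel sB) sB (uB v) X
            - (u3OfRecord₁₃ θ (objectsOfRecord₁₃ F N θ ℓ) k).EB (bsel sB) sB oneB X))
          - Real.log (Real.exp ((u3OfRecord₁₃ θ (objectsOfRecord₁₃ F N θ ℓ) k).EA sA (uA v) X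
            - (u3OfRecord₁₃ θ (objectsOfRecord₁₃ F N θ ℓ) k).EA sA oneA X))) = 0 :=
  Finset.sum_eq_zero fun X _ => by rw [devA_eq_zero, devB_eq_zero, sub_self]

end BackgroundBlind

/-! ## §2 The tube block (T) at the pinned bundle -/

section Tube

variable {F : T4Family} (θ : Stage13Params F N) (ℓ : U3Letters₁₁) (k : ℕ)

/-- **THE PAIR-DISC ANALYTICITY CLAUSE OF (T) FOLLOWS FROM `DecayBound` AT THE PIN, CONSTANT WITNESSES** [bookkeeping]: for every window `W`, constant
`E₀` and radius `r` (the link reading's `κ₁T · α(C₁T, q₁, s_j)` is one), the continuation `f := const (EA s U X)` is entire, matches both endpoints (the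
functional does not read `U ∕ U'`) and obeys the decay bound on the whole disc.  The tube is IDLE at def-W1's objects. [folklore] -/
theorem tubeDiscs_of_decayBound {W : Set (ℕ → ℝ)} {E₀ : ℝ}
    (h : DecayBound (u3OfRecord₁₃ θ (objectsOfRecord₁₃ F N θ ℓ) k).EA W E₀ (u3OfRecord₁₃ θ (objectsOfRecord₁₃ F N θ ℓ) k).κ)
    (s : ℕ → ℝ) (hs : s ∈ W) (X : (u3OfRecord₁₃ θ (objectsOfRecord₁₃ F N θ ℓ) k).C.Dom)
    (U U' : (u3OfRecord₁₃ θ (objectsOfRecord₁₃ F N θ ℓ) k).C.BgA) (r : ℝ) :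
    ∃ f : ℂ → ℂ, DifferentiableOn ℂ f (Metric.ball (0 : ℂ) r) ∧
      f 0 = ((u3OfRecord₁₃ θ (objectsOfRecord₁₃ F N θ ℓ) k).EA s U X : ℂ) ∧
      f ((u3OfRecord₁₃ θ (objectsOfRecord₁₃ F N θ ℓ) k).C.gauge U U' : ℂ) = ((u3OfRecord₁₃ θ (objectsOfRecord₁₃ F N θ ℓ) k).EA s U' X : ℂ) ∧
      ∀ z ∈ Metric.ball (0 : ℂ) r,
        ‖f z‖ ≤ E₀ * Real.exp (-((u3OfRecord₁₃ θ (objectsOfRecord₁₃ F N θ ℓ) k).κ * (u3OfRecord₁₃ θ (objectsOfRecord₁₃ F N θ ℓ) k).C.d X)) := by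
  refine ⟨fun _ => ((u3OfRecord₁₃ θ (objectsOfRecord₁₃ F N θ ℓ) k).EA s U X : ℂ), differentiableOn_const _, rfl, ?_, fun z _ => ?_⟩
  · exact congrArg (fun x : ℝ => (x : ℂ)) (EA_bg_irrel θ ℓ k s U U' X)
  · show ‖(((u3OfRecord₁₃ θ (objectsOfRecord₁₃ F N θ ℓ) k).EA s U X : ℝ) : ℂ)‖ ≤ _
    rw [Complex.norm_real, Real.norm_eq_abs]
    exact h s hs U X

/-- **`0 ≤ E₀T` FOLLOWS FROM (T)'s `DecayBound` AT THE PIN** whenever the window is inhabited (the pinned carriers' domain is inhabited by `pt 0 0 0 0`). [folklore] -/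
theorem E₀_nonneg_of_decayBound {W : Set (ℕ → ℝ)} {E₀ : ℝ}
    (h : DecayBound (u3OfRecord₁₃ θ (objectsOfRecord₁₃ F N θ ℓ) k).EA W E₀ (u3OfRecord₁₃ θ (objectsOfRecord₁₃ F N θ ℓ) k).κ) (hW : W.Nonempty) :
    0 ≤ E₀ := by
  obtain ⟨s, hs⟩ := hW
  have h1 := (abs_nonneg _).trans (h s hs PUnit.unit (pt 0 0 0 0))
  by_contra hE
  exact absurd h1 (not_le.mpr (mul_neg_of_neg_of_pos (not_le.mp hE) (Real.exp_pos _)))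

/-- `DecayBound` is antitone in the window. [folklore] -/
theorem decayBound_window_mono {C : T4OutputRate.Carriers} {Bg : Type} (E : T4OutputRate.Functional C Bg) {W W' : Set (ℕ → ℝ)} (hW : W' ⊆ W)
    {E₀ κ : ℝ} (h : DecayBound E W E₀ κ) : DecayBound E W' E₀ κ :=
  fun g hg U X => h g (hW hg) U X

/-- The tuning window is contained in the record window when `γ ≤ θ.γ`. [folklore] -/
theorem window_mono {γ γ' : ℝ} (hγ : γ ≤ γ') : Window γ ⊆ Window γ' :=
  fun _ hg i => ⟨(hg i).1, (hg i).2.trans hγ⟩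

/-- **(T)'s DECAY INPUT AT THE PIN, ON THE RECORD WINDOW, IMPLIES THE (D4) LETTER AT EVERY DIRECTION PAIR** [bookkeeping]: `DecayBound` of the pinned
run-A functional on `]0, θ.γ]^ℕ` with ONE constant `E₀` ⟹ `KernelDecayOfRecord₁₃ F N θ μ ν κ` for all `μ ν` (def-W1's `kernelDecay_of_decayBound` at
the merged term family of record).  The converse is NOT claimed ((D4)'s letter has a per-sequence constant). [folklore] -/
theorem kernelDecayOfRecord₁₃_of_decayBound {E₀ κ : ℝ}
    (h : DecayBound (u3OfRecord₁₃ θ (objectsOfRecord₁₃ F N θ ℓ) k).EA (Window θ.γ) E₀ κ) (μ ν : Fin 4) :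
    KernelDecayOfRecord₁₃ F N θ μ ν κ := by
  refine (kernelDecayOfRecord₁₃_iff F N θ ℓ k μ ν κ).2 fun g hg => ⟨E₀, fun k' z => ?_⟩
  have h1 := h g hg (((objectsOfRecord₁₃ F N θ ℓ).levelCarriers k).transport (bg k' μ ν z)) (pt k' μ ν z)
  rw [neg_mul]
  exact h1

end Tube

/-! ## §3 The (v′-16) gauge-domination clause `hdomC1` holds outright at the pinned bundle -/

section GaugeDomination

variable {F : T4Family} (θ : Stage13Params F N) (ℓ : U3Letters₁₁) (k : ℕ)

/-- **ANY NONNEGATIVE BOUND DOMINATES THE PINNED GAUGE** (it is `0`). [folklore] -/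
theorem gauge_le_of_nonneg {ι : Type} (uA : ℕ → ι → (u3OfRecord₁₃ θ (objectsOfRecord₁₃ F N θ ℓ) k).C.BgA)
    (uB : ℕ → ι → (u3OfRecord₁₃ θ (objectsOfRecord₁₃ F N θ ℓ) k).C.BgB) (K : ℕ) (v : ι) {M : ℝ} (hM : 0 ≤ M) :
    (u3OfRecord₁₃ θ (objectsOfRecord₁₃ F N θ ℓ) k).C.gauge (uA K v) ((u3OfRecord₁₃ θ (objectsOfRecord₁₃ F N θ ℓ) k).C.transport (uB K v)) ≤ M :=
  hM

/-- **THE GAUGE-DOMINATION CLAUSE `hdomC1` OF THE LINK READING HOLDS OUTRIGHT AT THE PIN** [decided]: in the shape displayed by the edition of record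
(`…N19RateEdgeHolderD4AtTuningWindow`, the last (v′-16) clause), for ANY N16-side letters `L Nper k₀ sel rd` and readings family `Rd`: the conclusion
`R.u3.C.gauge (uA K v) (R.u3.C.transport (uB K v)) ≤ M` is `0 ≤ M`, and its norm hypothesis at the site `0`, direction `0` gives `0 ≤ L^{k₀+K}·‖Z 0 0‖ ≤ M`.
NE3's reading machinery is untouched (a hypothesis shape, discharged here without being read). [folklore] -/
theorem hdomC1_atPin {ι' X' : Type} (Rd : T4EtaRateMin.Readings ι' X') (Lr Nper k₀ : ℕ)
    (sel : ℕ → (B7Prop1Explicit.Site 4 → Fin 4 → (Matrix (Fin N) (Fin N) ℂ)ˣ) → (B7Prop1Explicit.Site 4 → Fin 4 → (Matrix (Fin N) (Fin N) ℂ)ˣ))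
    (rd : ι' → (B7Prop1Explicit.Site 4 → Fin 4 → (Matrix (Fin N) (Fin N) ℂ)ˣ))
    (uA : ℕ → ι' → (u3OfRecord₁₃ θ (objectsOfRecord₁₃ F N θ ℓ) k).C.BgA) (uB : ℕ → ι' → (u3OfRecord₁₃ θ (objectsOfRecord₁₃ F N θ ℓ) k).C.BgB) :
    ∀ K : ℕ, ∀ v ∈ Rd.dom, ∀ (u : B7Prop1Explicit.Site 4 → (Matrix (Fin N) (Fin N) ℂ)ˣ)
      (Z : B7Prop1Explicit.Site 4 → Fin 4 → Matrix (Fin N) (Fin N) ℂ) (M : ℝ),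
      NE3EnergyShapes.IsUnitarySite u → NE3EnergyShapes.IsPeriodicSite u ((Nper * Lr ^ (k₀ + K) : ℕ) : ℤ) → T4AveragingDeficitWall.IsSkewDir Z →
      AveragingDeficitPeriodicCounting.IsPeriodicDir Z ((Nper * Lr ^ (k₀ + K) : ℕ) : ℤ) →
      B7Prop1Explicit.gaugeAct u (sel (k₀ + K) (rd v)) =
        T4AveragingDeficitWall.vary (B7Prop2Explicit.rescale Lr (B7Prop1Explicit.bavg Lr (sel (k₀ + K + 1) (rd v)))) Z 1 →
      (∀ (x : B7Prop1Explicit.Site 4) (κ : Fin 4), (Lr : ℝ) ^ (k₀ + K) * ‖Z x κ‖ ≤ M) →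
      (∀ (x : B7Prop1Explicit.Site 4) (μ κ : Fin 4), ((Lr : ℝ) ^ (k₀ + K)) ^ 2 *
          ‖T4AveragingDeficitWall.Ad (B7Prop2Explicit.rescale Lr (B7Prop1Explicit.bavg Lr (sel (k₀ + K + 1) (rd v)))
              (x + B7Prop1Explicit.e κ) μ) (Z (x + B7Prop1Explicit.e μ) κ) - Z x κ‖ ≤ M) →
      (u3OfRecord₁₃ θ (objectsOfRecord₁₃ F N θ ℓ) k).C.gauge (uA K v) ((u3OfRecord₁₃ θ (objectsOfRecord₁₃ F N θ ℓ) k).C.transport (uB K v)) ≤ M := by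
  intro K v _ u Z M _ _ _ _ _ hZ _
  have h0 : 0 ≤ (Lr : ℝ) ^ (k₀ + K) * ‖Z 0 0‖ := mul_nonneg (pow_nonneg (Nat.cast_nonneg _) _) (norm_nonneg _)
  exact gauge_le_of_nonneg θ ℓ k uA uB K v (h0.trans (hZ 0 0))

end GaugeDomination

/-! ## §4 Under the pin equation: transfer to the reading's bundle `(rateCarriersOfRecord₁₃CoPH 𝔯 F θ hP g₀ os k).u3` -/

section Pinned

variable (𝔯 : RateReading₁₃CoPH N) {F : T4Family} (θ : Stage13HParams F N) (hP : θ.Provisos₁₃CoPH F N) (g₀ : ℕ → ℝ) (os : List (ULoop F))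
  (ℓ : U3Letters₁₁) (hpin : (𝔯.lit F θ hP g₀ os).u3 = objectsOfRecord₁₃ F N θ.toStage13Params ℓ) (k : ℕ)

include hpin

/-- **UNDER THE PIN THE READING's NODE-U3 BUNDLE IS THE PINNED BUNDLE** (`rfl` + `hpin`). [folklore] -/
theorem u3_rateCarriersOfRecord₁₃CoPH_of_pin :
    (rateCarriersOfRecord₁₃CoPH 𝔯 F θ hP g₀ os k).u3 = u3OfRecord₁₃ θ.toStage13Params (objectsOfRecord₁₃ F N θ.toStage13Params ℓ) k := by
  show u3OfRecord₁₃ θ.toStage13Params (𝔯.lit F θ hP g₀ os).u3 k = _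
  rw [hpin]

/-- **AT THE READING UNDER THE PIN: NEITHER FUNCTIONAL READS THE BACKGROUND AND THE GAUGE VANISHES** —
the §1 faces transferred (all quantifiers inside, so the pin equation rewrites). [folklore] -/
theorem backgroundBlind_of_pin :
    (∀ (s : ℕ → ℝ) (U U' : (rateCarriersOfRecord₁₃CoPH 𝔯 F θ hP g₀ os k).u3.C.BgA) (X : (rateCarriersOfRecord₁₃CoPH 𝔯 F θ hP g₀ os k).u3.C.Dom),
        (rateCarriersOfRecord₁₃CoPH 𝔯 F θ hP g₀ os k).u3.EA s U X = (rateCarriersOfRecord₁₃CoPH 𝔯 F θ hP g₀ os k).u3.EA s U' X) ∧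
      (∀ (b : ℝ) (s : ℕ → ℝ) (U U' : (rateCarriersOfRecord₁₃CoPH 𝔯 F θ hP g₀ os k).u3.C.BgB) (X : (rateCarriersOfRecord₁₃CoPH 𝔯 F θ hP g₀ os k).u3.C.Dom),
        (rateCarriersOfRecord₁₃CoPH 𝔯 F θ hP g₀ os k).u3.EB b s U X = (rateCarriersOfRecord₁₃CoPH 𝔯 F θ hP g₀ os k).u3.EB b s U' X) ∧
      (∀ (U U' : (rateCarriersOfRecord₁₃CoPH 𝔯 F θ hP g₀ os k).u3.C.BgA), (rateCarriersOfRecord₁₃CoPH 𝔯 F θ hP g₀ os k).u3.C.gauge U U' = 0) := by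
  rw [u3_rateCarriersOfRecord₁₃CoPH_of_pin 𝔯 θ hP g₀ os ℓ hpin k]
  exact ⟨EA_bg_irrel _ ℓ k, EB_bg_irrel _ ℓ k, gauge_eq_zero _ ℓ k⟩

/-- **AT THE READING UNDER THE PIN: THE LEDGER's SLICE DEVIATION SUMS VANISH** (the left-hand side of (i)'s slice hypothesis ∕ `LedgerAtSync.size`), every
slice, scale reading, selector, backgrounds, tables. [folklore] -/
theorem sliceDev_eq_zero_of_pin :
    ∀ {ι : Type} (fac : Finset (rateCarriersOfRecord₁₃CoPH 𝔯 F θ hP g₀ os k).u3.C.Dom)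
      (sc : (rateCarriersOfRecord₁₃CoPH 𝔯 F θ hP g₀ os k).u3.C.Dom → ℕ) (j : ℕ)
      (sA sB : ℕ → ℝ) (bsel : (ℕ → ℝ) → ℝ)
      (uA : ι → (rateCarriersOfRecord₁₃CoPH 𝔯 F θ hP g₀ os k).u3.C.BgA) (oneA : (rateCarriersOfRecord₁₃CoPH 𝔯 F θ hP g₀ os k).u3.C.BgA)
      (uB : ι → (rateCarriersOfRecord₁₃CoPH 𝔯 F θ hP g₀ os k).u3.C.BgB) (oneB : (rateCarriersOfRecord₁₃CoPH 𝔯 F θ hP g₀ os k).u3.C.BgB) (v : ι),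
      ∑ X ∈ fac with sc X = j,
          (Real.log (Real.exp ((rateCarriersOfRecord₁₃CoPH 𝔯 F θ hP g₀ os k).u3.EB (bsel sB) sB (uB v) X
              - (rateCarriersOfRecord₁₃CoPH 𝔯 F θ hP g₀ os k).u3.EB (bsel sB) sB oneB X))
            - Real.log (Real.exp ((rateCarriersOfRecord₁₃CoPH 𝔯 F θ hP g₀ os k).u3.EA sA (uA v) X
              - (rateCarriersOfRecord₁₃CoPH 𝔯 F θ hP g₀ os k).u3.EA sA oneA X))) = 0 := by
  rw [u3_rateCarriersOfRecord₁₃CoPH_of_pin 𝔯 θ hP g₀ os ℓ hpin k]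
  intro ι fac sc j sA sB bsel uA oneA uB oneB v
  exact Finset.sum_eq_zero fun X _ => by rw [devA_eq_zero, devB_eq_zero, sub_self]

/-- **AT THE READING UNDER THE PIN: (T)'s PAIR DISCS FROM `DecayBound`, AND `DecayBound` ON THE RECORD WINDOW GIVES THE (D4) LETTER** — §2 transferred. [folklore] -/
theorem tube_of_pin :
    (∀ (W : Set (ℕ → ℝ)) (E₀ : ℝ),
        DecayBound (rateCarriersOfRecord₁₃CoPH 𝔯 F θ hP g₀ os k).u3.EA W E₀ (rateCarriersOfRecord₁₃CoPH 𝔯 F θ hP g₀ os k).u3.κ →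
        ∀ s ∈ W, ∀ (X : (rateCarriersOfRecord₁₃CoPH 𝔯 F θ hP g₀ os k).u3.C.Dom) (U U' : (rateCarriersOfRecord₁₃CoPH 𝔯 F θ hP g₀ os k).u3.C.BgA) (r : ℝ),
          ∃ f : ℂ → ℂ, DifferentiableOn ℂ f (Metric.ball (0 : ℂ) r) ∧
            f 0 = ((rateCarriersOfRecord₁₃CoPH 𝔯 F θ hP g₀ os k).u3.EA s U X : ℂ) ∧
            f ((rateCarriersOfRecord₁₃CoPH 𝔯 F θ hP g₀ os k).u3.C.gauge U U' : ℂ) = ((rateCarriersOfRecord₁₃CoPH 𝔯 F θ hP g₀ os k).u3.EA s U' X : ℂ) ∧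
            ∀ z ∈ Metric.ball (0 : ℂ) r, ‖f z‖ ≤ E₀ * Real.exp (-((rateCarriersOfRecord₁₃CoPH 𝔯 F θ hP g₀ os k).u3.κ *
              (rateCarriersOfRecord₁₃CoPH 𝔯 F θ hP g₀ os k).u3.C.d X))) ∧
      (∀ (E₀ κ : ℝ), DecayBound (rateCarriersOfRecord₁₃CoPH 𝔯 F θ hP g₀ os k).u3.EA (Window θ.γ) E₀ κ →
        ∀ μ ν : Fin 4, KernelDecayOfRecord₁₃ F N θ.toStage13Params μ ν κ) := by
  rw [u3_rateCarriersOfRecord₁₃CoPH_of_pin 𝔯 θ hP g₀ os ℓ hpin k]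
  exact ⟨fun W E₀ h s hs X U U' r => tubeDiscs_of_decayBound _ ℓ k h s hs X U U' r,
    fun E₀ κ h μ ν => kernelDecayOfRecord₁₃_of_decayBound _ ℓ k h μ ν⟩

end Pinned

end Summit.QuantumFields.YangMills.BalabanUVNodes.N19LinkReadingAtU3Pin

end
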